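import Summits.BirchSwinnertonDyer.BirchSwinnertonDyer.Theses.LeadingTerm
import Summits.BirchSwinnertonDyer.BirchSwinnertonDyer.Theorems.PAdicOrderV2PadicBSDrankLevelZero
import Literature.NumberTheory.EllipticCurves.IwasawaLeadingTerm
import Literature.NumberTheory.EllipticCurves.IwasawaOrderOfVanishing
import HarnessLib

/-!
# BirchSwinnertonDyer / LeadingTerm — crux `Consistency` (stmt-BirchSwinnertonDyer-16217),
# line `Sketch`: the Schneider–Kato locus split and the necessary Ш-transfer

The two theorems that gave line `Sketch` its name (crux idea `schneider-kato-locus-split`,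
ideator `planner-cruxidea-stmt-BirchSwinnertonDyer-16217-1-0`, kernel-checked there; landed here
by the lead with the statements expanded, no new definitions):

* `badLocus_coeff_eq_zero_of_facts` — OFF the regular locus `{Reg_p(D) ≠ 0 ∧ #Ш(E)[p^∞] < ∞}`
  the rank-indexed coefficient `[T^{r_MW}] L_p(E,T)` VANISHES, relative to the two named tree
  facts `Schneider1985_order_charGenerator` (Schneider 1985 as printed by Balakrishnan–Müller–Stein
  2016 Thm 1.7: `ord_T f_E ≥ r_MW`, with equality iff the canonical height is non-degenerate and
  `Ш(E)(p)` is finite) and `kato_divisibility` (Kato 2004 Thm 17.4: `f_E ∣ p^n L_p(E,T)`):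
  degenerate height or infinite `Ш(p)` ⇒ `ord_T f_E ≥ r_MW + 1` ⇒ `T^{r_MW+1} ∣ f_E ∣ g` with
  `ι g = p^n L_p` ⇒ `[T^{r_MW}] L_p = 0`. So on the bad locus the `p`-adic clause of the crux reads
  `0 = q · (1-α⁻¹)² · Reg_p`.
* `shaTransfer_of_consistency` — NECESSITY: given that bad-locus vanishing, the crux `Consistency`
  implies the `∞ → p` Ш-TRANSFER: at a good ordinary `p ≥ 5` with canonical datum `D` and newform
  `f`, `L^{(r_MW)}(E,1) ≠ 0 ∧ Reg_p(D) ≠ 0 ⇒ #Ш(E)[p^∞] < ∞` (if `Ш[p^∞]` were infinite then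
  `[T^r]L_p = 0`, so `q·(1-α⁻¹)²·Reg_p = 0`; `1-α⁻¹ ≠ 0` at a good ordinary prime —
  `levelZero_one_sub_unitRoot_inv_ne_zero`, MTT §I.14 — and `Reg_p ≠ 0` give `q = 0`, whence
  `L^{(r_MW)}(E,1) = r!·0·Ω⁺·Reg_∞ = 0`). Known for `r_MW ≤ 1` (Kolyvagin, Kato); OPEN from
  `r_MW = 2` on (no finiteness theorem for `Ш[p^∞]` at any prime of any curve of analytic rank
  `≥ 2`, Literature.Barriers.BirchSwinnertonDyer.SelmerRankBarrier): any proof of the crux proves it.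
* `shaTransfer_of_consistency_of_facts` packages the two.
-/

set_option linter.dupNamespace false

namespace Summit.BirchSwinnertonDyer.BirchSwinnertonDyer.Theorems

open scoped MatrixGroups ModularForm Classical
open CongruenceSubgroup Literature.NumberTheory.EllipticCurves
  Literature.NumberTheory.EllipticCurves.ModularForms WeierstrassCurve
open Summit.BirchSwinnertonDyer.BirchSwinnertonDyer.Theses.LeadingTerm (Consistency)

/-- **Bad-locus vanishing from Schneider 1985 + Kato 17.4.** Relative to the named facts
`Schneider1985_order_charGenerator` (as printed in Balakrishnan–Müller–Stein 2016, Thm 1.7) and the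
∀-closure of `kato_divisibility` (Kato, Astérisque 295, Thm 17.4), with the tree theorems supplying
the normalised cyclotomic pair (`exists_isCyclotomic_isTopGenerator_isCyclotomicVariable_holds`),
the Iwasawa module `X = W.selmerDualData κ hγ`, its finite generation
(`module_finite_of_isCyclotomic`) and the principality of its characteristic ideal
(`charIdeal_isPrincipal_holds`): at a good ordinary `p ≥ 5` with canonical datum `D` and newform
`f`, if `Reg_p(D) = 0` or `Ш(E)[p^∞]` is infinite then `[T^{r_MW}] L_p(E,T) = 0` — degenerate
height or infinite `Ш(p)` ⇒ `ord_T f_E ≠ r_MW` ⇒ `ord_T f_E ≥ r_MW + 1` ⇒ `T^{r_MW+1} ∣ f_E ∣ g`,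
`ι g = p^n L_p` ⇒ `[T^{r_MW}] L_p = 0`. [cite: Kato2004Asterisque, Thm. 17.4 (p. 273)] -/
theorem badLocus_coeff_eq_zero_of_facts :
    Literature.NumberTheory.EllipticCurves.Schneider1985_order_charGenerator → (∀ (W :
      WeierstrassCurve ℚ) [W.IsElliptic] [W.IsGloballyMinimal] (p : ℕ) [Fact p.Prime] (κ :
      Literature.NumberTheory.EllipticCurves.ZpExtension ℚ p) (γ : Field.absoluteGaloisGroup ℚ) {N :
      ℕ} [NeZero N] (f : CuspForm (CongruenceSubgroup.Gamma0 N) 2),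
      Literature.NumberTheory.EllipticCurves.kato_divisibility W p (κ := κ) (γ := γ) (f := f)) → ∀
      (W : WeierstrassCurve ℚ) [W.IsElliptic] [W.IsGloballyMinimal] (p : ℕ) [Fact p.Prime], 5 ≤ p →
      Literature.NumberTheory.EllipticCurves.IsOrdinaryAt W p → ∀ (D :
      WeierstrassCurve.PAdicHeightData W p), D.IsCanonical → ∀ ⦃N : ℕ⦄ [NeZero N] (f : CuspForm
      (CongruenceSubgroup.Gamma0 N) 2),
      Literature.NumberTheory.EllipticCurves.ModularForms.IsNewformOf W f →
      (WeierstrassCurve.padicRegulator D = 0 ∨ ¬ Finite (AddCommGroup.primaryComponent W.sha p)) →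
      PowerSeries.coeff W.mordellWeilRank (Literature.NumberTheory.EllipticCurves.padicLFunction f
      (Literature.NumberTheory.EllipticCurves.unitRoot W p : ℚ_[p])) = 0 := by
  intro hS hkato W _ _ p _ hp hord D hD N _ f hf hbad
  have hp2 : p ≠ 2 := by omega
  obtain ⟨κ, hκ, γ, hγ, hγ'⟩ := exists_isCyclotomic_isTopGenerator_isCyclotomicVariable_holds p
  set X := W.selmerDualData κ hγ with hXdef
  haveI : Module.Finite (IwasawaAlgebra p) X.X := X.module_finite_of_isCyclotomic W κ hκ hγ
  obtain ⟨hXtors, ⟨n, g, hg, hιg⟩, -⟩ := hkato W p κ γ f hp2 hord hκ hγ hγ' hf X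
  have hprin : (X.charIdeal).IsPrincipal := charIdeal_isPrincipal_holds p X.X
  obtain ⟨fE, hfE⟩ := hprin.principal
  have hfE' : X.charIdeal = Ideal.span {fE} := hfE
  obtain ⟨hle, hiff, -⟩ := hS W p hp hord.1 hord.2 κ γ hκ hγ hγ' X hXtors fE hfE' D hD
  -- off the regular locus the order of vanishing of `f_E` exceeds the rank
  have hne : fE.order ≠ W.mordellWeilRank := by
    intro heq
    obtain ⟨hSch, hfin⟩ := hiff.mp heq
    rcases hbad with h | h
    · exact hSch h
    · exact h hfin
  have hlt : (W.mordellWeilRank : ℕ∞) < fE.order := lt_of_le_of_ne hle (Ne.symm hne)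
  have hle' : ((W.mordellWeilRank + 1 : ℕ) : ℕ∞) ≤ fE.order := by
    rw [Nat.cast_add, Nat.cast_one]
    exact Order.add_one_le_of_lt hlt
  have hdvd : (PowerSeries.X : IwasawaAlgebra p) ^ (W.mordellWeilRank + 1) ∣ fE :=
    PowerSeries.X_pow_dvd_iff.mpr fun m hm =>
      PowerSeries.coeff_of_lt_order m (lt_of_lt_of_le (by exact_mod_cast hm) hle')
  -- `g ∈ (fE)` so `T^{r+1} ∣ g`, and `ι g = p^n · L_p`
  have hg' : fE ∣ g := by
    rw [hfE'] at hg
    exact Ideal.mem_span_singleton.mp hg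
  have hdvdg : (PowerSeries.X : IwasawaAlgebra p) ^ (W.mordellWeilRank + 1) ∣ g := hdvd.trans hg'
  have hdvdι : (PowerSeries.X : PowerSeries ℚ_[p]) ^ (W.mordellWeilRank + 1) ∣
      PowerSeries.C ((p : ℚ_[p]) ^ n) * padicLFunction f (unitRoot W p : ℚ_[p]) := by
    rw [← hιg]
    have := map_dvd (iwasawaToPowerSeries p) hdvdg
    simpa [map_pow, PowerSeries.map_X] using this
  have hcoeff := (PowerSeries.X_pow_dvd_iff.mp hdvdι) W.mordellWeilRank (Nat.lt_succ_self _)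
  rw [PowerSeries.coeff_C_mul] at hcoeff
  have hpn : ((p : ℚ_[p]) ^ n) ≠ 0 := pow_ne_zero _ (by exact_mod_cast (Fact.out : p.Prime).ne_zero)
  exact (mul_eq_zero.mp hcoeff).resolve_left hpn

/-- **Necessity of the Ш-transfer.** If the rank-indexed coefficient `[T^{r_MW}]L_p` vanishes off
the regular locus (hypothesis `hbad`, = `badLocus_coeff_eq_zero_of_facts` relative to Schneider +
Kato), then the crux `Consistency` implies: at a good ordinary `p ≥ 5` with canonical datum `D`
and newform `f`, `L^{(r_MW)}(E,1) ≠ 0` and `Reg_p(D) ≠ 0` force `Ш(E)[p^∞]` to be FINITE. Indeed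
if `Ш[p^∞]` were infinite then `[T^r] L_p = 0`, so `q · (1 - α⁻¹)² · Reg_p = 0`; `1 - α⁻¹ ≠ 0`
at a good ordinary prime (`levelZero_one_sub_unitRoot_inv_ne_zero`, Mazur–Tate–Teitelbaum §I.14)
and `Reg_p ≠ 0` give `q = 0`, and the archimedean clause reads `L^{(r_MW)}(E,1) = 0`. Open from
`r_MW = 2` on: any proof of the crux proves rank-`≥ 2` finiteness of `Ш[p^∞]` at non-degenerate
primes. [cite: MazurTateTeitelbaum1986Invent, §I.14] -/
theorem shaTransfer_of_consistency :
    (∀ (W : WeierstrassCurve ℚ) [W.IsElliptic] [W.IsGloballyMinimal] (p : ℕ) [Fact p.Prime], 5 ≤ p →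
      Literature.NumberTheory.EllipticCurves.IsOrdinaryAt W p → ∀ (D :
      WeierstrassCurve.PAdicHeightData W p), D.IsCanonical → ∀ ⦃N : ℕ⦄ [NeZero N] (f : CuspForm
      (CongruenceSubgroup.Gamma0 N) 2),
      Literature.NumberTheory.EllipticCurves.ModularForms.IsNewformOf W f →
      (WeierstrassCurve.padicRegulator D = 0 ∨ ¬ Finite (AddCommGroup.primaryComponent W.sha p)) →
      PowerSeries.coeff W.mordellWeilRank (Literature.NumberTheory.EllipticCurves.padicLFunction f
      (Literature.NumberTheory.EllipticCurves.unitRoot W p : ℚ_[p])) = 0) →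
      Summit.BirchSwinnertonDyer.BirchSwinnertonDyer.Theses.LeadingTerm.Consistency → ∀ (W :
      WeierstrassCurve ℚ) [W.IsElliptic] [W.IsGloballyMinimal] (p : ℕ) [Fact p.Prime], 5 ≤ p →
      Literature.NumberTheory.EllipticCurves.IsOrdinaryAt W p → ∀ (D :
      WeierstrassCurve.PAdicHeightData W p), D.IsCanonical → ∀ ⦃N : ℕ⦄ [NeZero N] (f : CuspForm
      (CongruenceSubgroup.Gamma0 N) 2),
      Literature.NumberTheory.EllipticCurves.ModularForms.IsNewformOf W f → iteratedDeriv
      W.mordellWeilRank W.entireLFunction 1 ≠ 0 → WeierstrassCurve.padicRegulator D ≠ 0 → Finite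
      (AddCommGroup.primaryComponent W.sha p) := by
  intro hbad hC W _ _ p _ hp hord D hD N _ f hf hL hReg
  by_contra hinf
  have h0 := hbad W p hp hord D hD f hf (Or.inr hinf)
  obtain ⟨-, -, q, hA, hP⟩ := hC W p hp hord D hD f hf
  rw [h0, zero_mul] at hP
  have hε := levelZero_one_sub_unitRoot_inv_ne_zero W p hord
  have hq : (q : ℚ_[p]) = 0 := by
    rcases mul_eq_zero.mp hP.symm with h | h
    · rcases mul_eq_zero.mp h with h' | h'
      · exact h'
      · exact absurd h' (pow_ne_zero _ hε)
    · exact absurd h hReg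
  have hq' : q = 0 := by exact_mod_cast hq
  apply hL
  rw [hA, hq']
  push_cast
  ring

/-- **Packaging**: relative to the two deep named facts (Schneider 1985 via BMS 2016 Thm 1.7;
Kato 2004 Thm 17.4) the crux `Consistency` implies the `∞ → p` Ш-transfer outright.
[cite: Kato2004Asterisque, Thm. 17.4 (p. 273)] -/
theorem shaTransfer_of_consistency_of_facts :
    Literature.NumberTheory.EllipticCurves.Schneider1985_order_charGenerator → (∀ (W :
      WeierstrassCurve ℚ) [W.IsElliptic] [W.IsGloballyMinimal] (p : ℕ) [Fact p.Prime] (κ :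
      Literature.NumberTheory.EllipticCurves.ZpExtension ℚ p) (γ : Field.absoluteGaloisGroup ℚ) {N :
      ℕ} [NeZero N] (f : CuspForm (CongruenceSubgroup.Gamma0 N) 2),
      Literature.NumberTheory.EllipticCurves.kato_divisibility W p (κ := κ) (γ := γ) (f := f)) →
      Summit.BirchSwinnertonDyer.BirchSwinnertonDyer.Theses.LeadingTerm.Consistency → ∀ (W :
      WeierstrassCurve ℚ) [W.IsElliptic] [W.IsGloballyMinimal] (p : ℕ) [Fact p.Prime], 5 ≤ p →
      Literature.NumberTheory.EllipticCurves.IsOrdinaryAt W p → ∀ (D :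
      WeierstrassCurve.PAdicHeightData W p), D.IsCanonical → ∀ ⦃N : ℕ⦄ [NeZero N] (f : CuspForm
      (CongruenceSubgroup.Gamma0 N) 2),
      Literature.NumberTheory.EllipticCurves.ModularForms.IsNewformOf W f → iteratedDeriv
      W.mordellWeilRank W.entireLFunction 1 ≠ 0 → WeierstrassCurve.padicRegulator D ≠ 0 → Finite
      (AddCommGroup.primaryComponent W.sha p) :=
  fun hS hkato hC => shaTransfer_of_consistency (badLocus_coeff_eq_zero_of_facts hS hkato) hC

end Summit.BirchSwinnertonDyer.BirchSwinnertonDyer.Theorems
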